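import Summits.QuantumFields.YangMills.Theorems.RectangleDominationShallowArithmetic
import Literature.MathematicalPhysics.QuantumFieldTheory.Balaban1983to89.WilsonLoopLimit

/-!
# Route `RectangleDomination` (LINE 17 of seat `ym-r3-idea-2`; rung R3 of LADDER-YM = `T3YM3TorusStatement.YM3TorusSU2`, a
# RECORD rung — not d = 4, not the Clay statement) — THE SHALLOW ENGINE of the glue `HistoryTailOfRectanglesL`
# (support item stmt-QuantumFields-23867), part 2: the shallow per-plaquette tail from the two cruxes

At the SHALLOW averaged heights `3j ≤ K` (depth `h = K − j ≥ 2j`) the BARE event `{θ_{b₀}(h) ≤ |Ū^{j}(∂p) − 1|}` of one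
block-averaged plaquette has, for one family `F` and one coupling `0 < γ ≤ 1`, Gibbs mass
`≤ 288·C·L^{3m}·R^{A+2}·β_h^{3A+9}·exp(−(c·c₂)^α·p_{1,1}(g_h)²)` — a LOG-SQUARE rate, the minimal per-plaquette input of the
history-tail bookkeeping — GIVEN the rectangle tail of `RectangleTailL` (stmt-23864; constants `α, c, C, A`) and the deterministic
domination of `ShallowRectangleDominationL` (stmt-23865; `C₃, R, η₀`) for `F` at `γ`, a profile with `α(2p₀ − 3) ≥ 2`, and the
side-condition smallness `√(L^j)θ_{b₀}(h) ≤ 2C₃·min(η₀, 1)` (part 1, `exists_gamma_sqrt_pow_mul_θBal_le`).  Three steps: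
`real_bare_le_count_mul` (contrapositive of the domination at `η = θ/(2C₃(j+1))` + union bound over the rectangles
`(i ≤ j, x, μ, ν, a, b ≤ ⌊RL^j⌋)`), `rect_event_le` (one rectangle: the tail at `t = η√(L^i/L^j)` and part 1's exponent
comparison), `count_le` (`(j+1)·(2L^{m+K})³·9·(⌊RL^j⌋+1)² ≤ 288·L^{3m}R²β_h⁹`), assembled in `shallow_perPlaquette`.

HONEST FRAMING: bookkeeping only (a union bound + real analysis), with the two cruxes as HYPOTHESES; nothing here proves them,
`HistoryTailL`, the rung R3, or anything about the Yang–Mills mass gap.  No `def`, no `sorry`.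

References: T. Bałaban, CMP **102** (1985) 255–275 [Balaban1985UV3] ((1)–(3) p.256, (7) p.257); C. King, CMP **103** (1986)
323–349 [King1986].
-/

set_option autoImplicit false

noncomputable section

open MeasureTheory
open scoped BigOperators
open Literature.MathematicalPhysics.QuantumFieldTheory.Balaban1983to89
open Literature.MathematicalPhysics.QuantumFieldTheory.Balaban1983to89.T3ContinuumYM3Torus
open Literature.MathematicalPhysics.QuantumFieldTheory.Balaban1983to89.T3UnitScaleTilt
open Literature.MathematicalPhysics.QuantumFieldTheory.Balaban1983to89.T3Thresholds
open Literature.MathematicalPhysics.QuantumFieldTheory.Balaban1983to89.T3ThresholdSmallness (sqrt_coupling_pos_le)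

namespace Summit.QuantumFields.YangMills.Theorems.RectangleDominationShallow

/-! ## §5 The shallow per-plaquette tail from the two cruxes (one family, one coupling) -/

section Shallow

/-- **CONTRAPOSITIVE OF THE DOMINATION + UNION BOUND** (one cut-off `K`, one height `j ≤ K`, one plaquette `p`; any finite
measure).  If the deterministic domination holds at `(K, j, p, η)` — «every contractible rectangle with `i ≤ j`,
`a + b ≤ R·L^i` has `|U(∂rect) − 1| ≤ η√(L^i/L^j)` ⇒ `|Ū^{j}(∂p) − 1| ≤ C₃(j+1)η`» — and `C₃(j+1)η < θ`, then the bare event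
`{θ ≤ |Ū^{j}(∂p) − 1|}` lies in the union of the rectangle events `{η√(L^i/L^j) ≤ |U(∂rect) − 1|}` over `i ≤ j`, corners `x`,
directions `μ, ν`, sides `a, b ≤ ⌊R·L^j⌋`; so if each of them has mass `≤ B` (`B ≥ 0`), the bare event has mass
`≤ (j+1)·#sites·9·(⌊RL^j⌋+1)²·B`. [cite: Balaban1985UV3, (7) p.257] -/
theorem real_bare_le_count_mul (F : T3Family) {K j : ℕ} (p : Plaq (F.P K) j)
    (μm : Measure (GaugeField (F.P K) 0 (Matrix.specialUnitaryGroup (Fin 2) ℂ))) [IsFiniteMeasure μm]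
    {θ η C₃ R B : ℝ} (hR : 0 ≤ R) (hB : 0 ≤ B) (hθ : C₃ * ((j : ℝ) + 1) * η < θ)
    (hdom : ∀ U : GaugeField (F.P K) 0 (Matrix.specialUnitaryGroup (Fin 2) ℂ),
      (∀ (i a b : ℕ) (x : Site (F.P K) 0) (μ ν : Fin (F.P K).d), μ ≠ ν → i ≤ j → 1 ≤ a → 1 ≤ b →
        2 * (a + b) < (F.P K).sitesPerDir 0 → ((a : ℝ) + b) ≤ R * (F.L : ℝ) ^ i →
        GaugeGroup.dist1 (Missing.pathHol U (Missing.rectLoop x μ ν a b)) ≤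
          η * Real.sqrt ((F.L : ℝ) ^ i / (F.L : ℝ) ^ j)) →
      GaugeGroup.dist1 (GaugeField.plaqHol
        (Averaging.iter (fun i => BlockAveraging.blockAvg (P := F.P K) (j := i) T3UnitLawDensityEML.ℰp) j U) p) ≤
        C₃ * ((j : ℝ) + 1) * η)
    (hrect : ∀ (i a b : ℕ) (x : Site (F.P K) 0) (μ ν : Fin (F.P K).d), μ ≠ ν → i ≤ j → 1 ≤ a → 1 ≤ b →
      2 * (a + b) < (F.P K).sitesPerDir 0 → ((a : ℝ) + b) ≤ R * (F.L : ℝ) ^ i →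
      μm.real {U | η * Real.sqrt ((F.L : ℝ) ^ i / (F.L : ℝ) ^ j) ≤
        GaugeGroup.dist1 (Missing.pathHol U (Missing.rectLoop x μ ν a b))} ≤ B) :
    μm.real {U | θ ≤ GaugeGroup.dist1 (GaugeField.plaqHol
        (Averaging.iter (fun i => BlockAveraging.blockAvg (P := F.P K) (j := i) T3UnitLawDensityEML.ℰp) j U) p)} ≤
      (((j + 1) * (Fintype.card (Site (F.P K) 0) *
        (3 * (3 * ((⌊R * (F.L : ℝ) ^ j⌋₊ + 1) * (⌊R * (F.L : ℝ) ^ j⌋₊ + 1))))) : ℕ) : ℝ) * B := by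
  classical
  have hLr1 : (1 : ℝ) ≤ F.L := by exact_mod_cast F.hL.2.le
  -- the index set of rectangles and the rectangle events
  obtain ⟨N, hN_def⟩ : ∃ N : ℕ, N = ⌊R * (F.L : ℝ) ^ j⌋₊ := ⟨_, rfl⟩
  rw [← hN_def]
  obtain ⟨S, hS_def⟩ : ∃ S : Finset (ℕ × Site (F.P K) 0 × Fin (F.P K).d × Fin (F.P K).d × ℕ × ℕ),
      S = Finset.range (j + 1) ×ˢ (Finset.univ ×ˢ (Finset.univ ×ˢ (Finset.univ ×ˢ
        (Finset.range (N + 1) ×ˢ Finset.range (N + 1))))) := ⟨_, rfl⟩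
  obtain ⟨E, hE_def⟩ : ∃ E : ℕ × Site (F.P K) 0 × Fin (F.P K).d × Fin (F.P K).d × ℕ × ℕ →
      Set (GaugeField (F.P K) 0 (Matrix.specialUnitaryGroup (Fin 2) ℂ)),
      E = fun s => {U | (s.2.2.1 ≠ s.2.2.2.1 ∧ s.1 ≤ j ∧ 1 ≤ s.2.2.2.2.1 ∧ 1 ≤ s.2.2.2.2.2 ∧
          2 * (s.2.2.2.2.1 + s.2.2.2.2.2) < (F.P K).sitesPerDir 0 ∧
          ((s.2.2.2.2.1 : ℝ) + s.2.2.2.2.2) ≤ R * (F.L : ℝ) ^ s.1) ∧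
        η * Real.sqrt ((F.L : ℝ) ^ s.1 / (F.L : ℝ) ^ j) ≤
          GaugeGroup.dist1 (Missing.pathHol U
            (Missing.rectLoop s.2.1 s.2.2.1 s.2.2.2.1 s.2.2.2.2.1 s.2.2.2.2.2))} := ⟨_, rfl⟩
  -- (i) the contrapositive of the domination: the bare event lies in the union of the rectangle events
  have hsub : {U : GaugeField (F.P K) 0 (Matrix.specialUnitaryGroup (Fin 2) ℂ) | θ ≤ GaugeGroup.dist1
      (GaugeField.plaqHol (Averaging.iter (fun i => BlockAveraging.blockAvg (P := F.P K) (j := i)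
        T3UnitLawDensityEML.ℰp) j U) p)} ⊆ ⋃ s ∈ S, E s := by
    intro U hU
    rw [Set.mem_setOf_eq] at hU
    by_contra hnot
    have hsmall : ∀ (i a b : ℕ) (x : Site (F.P K) 0) (μ ν : Fin (F.P K).d), μ ≠ ν → i ≤ j → 1 ≤ a → 1 ≤ b →
        2 * (a + b) < (F.P K).sitesPerDir 0 → ((a : ℝ) + b) ≤ R * (F.L : ℝ) ^ i →
        GaugeGroup.dist1 (Missing.pathHol U (Missing.rectLoop x μ ν a b)) ≤
          η * Real.sqrt ((F.L : ℝ) ^ i / (F.L : ℝ) ^ j) := by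
      intro i a b x μ ν hμν hij ha hb hab habR
      have hRLj : ((a : ℝ) + b) ≤ R * (F.L : ℝ) ^ j :=
        habR.trans (mul_le_mul_of_nonneg_left (pow_le_pow_right₀ hLr1 hij) hR)
      have ha0 : (0 : ℝ) ≤ a := Nat.cast_nonneg a
      have hb0 : (0 : ℝ) ≤ b := Nat.cast_nonneg b
      have hRL0 : 0 ≤ R * (F.L : ℝ) ^ j := by positivity
      have haN : a ≤ N := by rw [hN_def]; exact (Nat.le_floor_iff hRL0).mpr (by linarith)
      have hbN : b ≤ N := by rw [hN_def]; exact (Nat.le_floor_iff hRL0).mpr (by linarith)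
      have hs : (i, x, μ, ν, a, b) ∈ S := by
        rw [hS_def]
        simp only [Finset.mem_product, Finset.mem_range, Finset.mem_univ, true_and]
        omega
      by_contra hlt
      have hlt' : η * Real.sqrt ((F.L : ℝ) ^ i / (F.L : ℝ) ^ j) ≤
          GaugeGroup.dist1 (Missing.pathHol U (Missing.rectLoop x μ ν a b)) := (not_le.mp hlt).le
      refine hnot (Set.mem_iUnion₂.mpr ⟨(i, x, μ, ν, a, b), hs, ?_⟩)
      rw [hE_def]
      exact ⟨⟨hμν, hij, ha, hb, hab, habR⟩, hlt'⟩
    have hdomU := hdom U hsmall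
    linarith
  -- (ii) each rectangle event has mass at most `B`
  have hE : ∀ s ∈ S, μm.real (E s) ≤ B := by
    rintro ⟨i, x, μ, ν, a, b⟩ -
    by_cases hv : (μ ≠ ν ∧ i ≤ j ∧ 1 ≤ a ∧ 1 ≤ b ∧ 2 * (a + b) < (F.P K).sitesPerDir 0 ∧
        ((a : ℝ) + b) ≤ R * (F.L : ℝ) ^ i)
    · obtain ⟨hμν, hij, ha, hb, hab, habR⟩ := hv
      have hEeq : E (i, x, μ, ν, a, b) = {U | η * Real.sqrt ((F.L : ℝ) ^ i / (F.L : ℝ) ^ j) ≤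
          GaugeGroup.dist1 (Missing.pathHol U (Missing.rectLoop x μ ν a b))} := by
        ext U
        rw [hE_def]
        simp only [Set.mem_setOf_eq]
        exact ⟨fun hU => hU.2, fun hU => ⟨⟨hμν, hij, ha, hb, hab, habR⟩, hU⟩⟩
      rw [hEeq]
      exact hrect i a b x μ ν hμν hij ha hb hab habR
    · have hsub0 : E (i, x, μ, ν, a, b) ⊆ ∅ := by
        intro U hU
        rw [hE_def] at hU
        simp only [Set.mem_setOf_eq] at hU
        exact hv hU.1
      exact (measureReal_mono hsub0 (measure_ne_top _ _)).trans (by rw [measureReal_empty]; exact hB)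
  -- (iii) the count
  have hScard : S.card = (j + 1) * (Fintype.card (Site (F.P K) 0) * (3 * (3 * ((N + 1) * (N + 1))))) := by
    rw [hS_def, Finset.card_product, Finset.card_product, Finset.card_product, Finset.card_product,
      Finset.card_product]
    simp only [Finset.card_range, Finset.card_univ, Fintype.card_fin]
    rfl
  rw [← hScard]
  exact measureReal_le_card_mul μm S E hsub hE

/-- **ONE RECTANGLE EVENT** (any measure on the fine fields of the `K`-th approximation).  Under the rectangle tail at
cut-off `K` (constants `C, A, c, α` of `RectangleTailL`, `β_K = (γL^{-K})⁻¹`), for a contractible rectangle with `i ≤ j`,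
`μ ≠ ν`, `1 ≤ a, b`, `2(a+b) <` sites per direction and `a + b ≤ R·L^i`, a threshold `0 < η ≤ 1` with
`η²β_K = (b₀u^{p₀})²L^j/(4C₃²(j+1)²)` (`u = 1 + ℓ`, `ℓ = log g_h⁻¹ ≥ j`, `j·log L ≤ ℓ`) and a profile with `α(2p₀ − 3) ≥ 2`: the
event `{η√(L^i/L^j) ≤ |U(∂rect) − 1|}` has mass `≤ C·β_K^A·(R·L^j)^A·exp(−(c·c₂)^α u²)`, `c₂ = b₀²/(4C₃²R(1 + log R))` (§3).
[cite: Balaban1985UV3, (7) p.257] -/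
theorem rect_event_le (F : T3Family) {K j i a b A : ℕ} (x : Site (F.P K) 0) (μ ν : Fin (F.P K).d)
    (μm : Measure (GaugeField (F.P K) 0 (Matrix.specialUnitaryGroup (Fin 2) ℂ)))
    {γ α c C C₃ R b₀ p₀ η ℓ : ℝ} (hγ : 0 < γ) (hα : 0 < α) (hc : 0 < c) (hC : 0 ≤ C) (hC₃ : 0 < C₃)
    (hR : 2 ≤ R) (hb₀ : 0 < b₀) (hαp : 2 ≤ α * (2 * p₀ - 3)) (hℓ0 : 0 ≤ ℓ) (hjℓ : (j : ℝ) ≤ ℓ)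
    (hjlogℓ : (j : ℝ) * Real.log F.L ≤ ℓ) (hη0 : 0 < η) (hη1 : η ≤ 1)
    (hηβ : η ^ 2 * (γ * ((F.L : ℝ)⁻¹) ^ K)⁻¹ =
      (b₀ * (1 + ℓ) ^ p₀) ^ 2 * (F.L : ℝ) ^ j / (4 * C₃ ^ 2 * ((j : ℝ) + 1) ^ 2))
    (hRT : ∀ (a b : ℕ) (x : Site (F.P K) 0) (μ ν : Fin (F.P K).d) (t : ℝ), μ ≠ ν → 1 ≤ a → 1 ≤ b →
      2 * (a + b) < (F.P K).sitesPerDir 0 → 0 < t → t ≤ 1 →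
      μm.real {U | t ≤ GaugeGroup.dist1 (Missing.pathHol U (Missing.rectLoop x μ ν a b))} ≤
        C * (γ * ((F.L : ℝ)⁻¹) ^ K)⁻¹ ^ A * ((a : ℝ) + b) ^ A *
          Real.exp (-((c * (t ^ 2 * (γ * ((F.L : ℝ)⁻¹) ^ K)⁻¹ /
            (((a : ℝ) + b) * (1 + Real.log ((a : ℝ) + b))))) ^ α)))
    (hμν : μ ≠ ν) (hij : i ≤ j) (ha : 1 ≤ a) (hb : 1 ≤ b) (hab : 2 * (a + b) < (F.P K).sitesPerDir 0)
    (habR : ((a : ℝ) + b) ≤ R * (F.L : ℝ) ^ i) :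
    μm.real {U | η * Real.sqrt ((F.L : ℝ) ^ i / (F.L : ℝ) ^ j) ≤
        GaugeGroup.dist1 (Missing.pathHol U (Missing.rectLoop x μ ν a b))} ≤
      C * (γ * ((F.L : ℝ)⁻¹) ^ K)⁻¹ ^ A * (R * (F.L : ℝ) ^ j) ^ A *
        Real.exp (-((c * (b₀ ^ 2 / (4 * C₃ ^ 2 * R * (1 + Real.log R)))) ^ α * (1 + ℓ) ^ 2)) := by
  have hLr1 : (1 : ℝ) ≤ F.L := by exact_mod_cast F.hL.2.le
  have hLr0 : (0 : ℝ) < F.L := by linarith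
  have hR0 : 0 < R := by linarith
  have hβK0 : 0 ≤ (γ * ((F.L : ℝ)⁻¹) ^ K)⁻¹ := by positivity
  have hratio0 : 0 < (F.L : ℝ) ^ i / (F.L : ℝ) ^ j := by positivity
  have hratio : (F.L : ℝ) ^ i / (F.L : ℝ) ^ j ≤ 1 :=
    (div_le_one (pow_pos hLr0 j)).mpr (pow_le_pow_right₀ hLr1 hij)
  have ht0 : 0 < η * Real.sqrt ((F.L : ℝ) ^ i / (F.L : ℝ) ^ j) := by positivity
  have ht1 : η * Real.sqrt ((F.L : ℝ) ^ i / (F.L : ℝ) ^ j) ≤ 1 :=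
    (mul_le_mul_of_nonneg_left (Real.sqrt_le_one.mpr hratio) hη0.le).trans (by linarith)
  have htail := hRT a b x μ ν _ hμν ha hb hab ht0 ht1
  have hs2 : (2 : ℝ) ≤ (a : ℝ) + b := by
    have ha' : (1 : ℝ) ≤ a := by exact_mod_cast ha
    have hb' : (1 : ℝ) ≤ b := by exact_mod_cast hb
    linarith
  have habj : ((a : ℝ) + b) ≤ R * (F.L : ℝ) ^ j :=
    habR.trans (mul_le_mul_of_nonneg_left (pow_le_pow_right₀ hLr1 hij) hR0.le)
  have hiℓ : (i : ℝ) * Real.log F.L ≤ ℓ :=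
    (mul_le_mul_of_nonneg_right (by exact_mod_cast hij) (Real.log_nonneg hLr1)).trans hjlogℓ
  -- the identity `t²β_K = (b₀u^{p₀})²·L^i/(4C₃²(j+1)²)`
  have hid : (η * Real.sqrt ((F.L : ℝ) ^ i / (F.L : ℝ) ^ j)) ^ 2 * (γ * ((F.L : ℝ)⁻¹) ^ K)⁻¹ =
      (b₀ * (1 + ℓ) ^ p₀) ^ 2 * (F.L : ℝ) ^ i / (4 * C₃ ^ 2 * ((j : ℝ) + 1) ^ 2) := by
    have hLj0 : (F.L : ℝ) ^ j ≠ 0 := pow_ne_zero j hLr0.ne'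
    calc (η * Real.sqrt ((F.L : ℝ) ^ i / (F.L : ℝ) ^ j)) ^ 2 * (γ * ((F.L : ℝ)⁻¹) ^ K)⁻¹
        = (η ^ 2 * (γ * ((F.L : ℝ)⁻¹) ^ K)⁻¹) * ((F.L : ℝ) ^ i / (F.L : ℝ) ^ j) := by
          rw [mul_pow, Real.sq_sqrt hratio0.le]; ring
      _ = (b₀ * (1 + ℓ) ^ p₀) ^ 2 * (F.L : ℝ) ^ i / (4 * C₃ ^ 2 * ((j : ℝ) + 1) ^ 2) := by
          rw [hηβ]; field_simp
  rw [hid] at htail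
  have hmain := logSq_le_exponent (s := (a : ℝ) + b) (Li := (F.L : ℝ) ^ i) (logL := Real.log F.L) hα hc hC₃
    hR hb₀ hαp hℓ0 hjℓ hiℓ (pow_pos hLr0 i) (Real.log_pow _ _) hs2 habR
  have hexp : Real.exp (-((c * ((b₀ * (1 + ℓ) ^ p₀) ^ 2 * (F.L : ℝ) ^ i / (4 * C₃ ^ 2 * ((j : ℝ) + 1) ^ 2) /
      (((a : ℝ) + b) * (1 + Real.log ((a : ℝ) + b))))) ^ α)) ≤
      Real.exp (-((c * (b₀ ^ 2 / (4 * C₃ ^ 2 * R * (1 + Real.log R)))) ^ α * (1 + ℓ) ^ 2)) :=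
    Real.exp_le_exp.mpr (neg_le_neg hmain)
  have hpowA : ((a : ℝ) + b) ^ A ≤ (R * (F.L : ℝ) ^ j) ^ A := pow_le_pow_left₀ (by positivity) habj A
  refine htail.trans ?_
  exact mul_le_mul (mul_le_mul_of_nonneg_left hpowA (by positivity)) hexp (Real.exp_nonneg _) (by positivity)

/-- **THE COUNT**: `(j+1)·#sites(T^{(K)}_0)·9·(⌊RL^j⌋+1)² ≤ 288·L^{3m}·R²·β_h⁹` when `L^j ≤ β_h`, `L^K ≤ β_h²`, `β_h ≥ 1`,
`R ≥ 2` (`#sites = (2L^{m+K})³`, `j + 1 ≤ 2^j ≤ L^j`). [cite: Balaban1985UV3, (1)-(3) p.256] -/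
theorem count_le (F : T3Family) {K j : ℕ} {R β : ℝ} (hR : 2 ≤ R) (hβ1 : 1 ≤ β) (hLjβ : (F.L : ℝ) ^ j ≤ β)
    (hLKβ : (F.L : ℝ) ^ K ≤ β ^ 2) :
    (((j + 1) * (Fintype.card (Site (F.P K) 0) *
        (3 * (3 * ((⌊R * (F.L : ℝ) ^ j⌋₊ + 1) * (⌊R * (F.L : ℝ) ^ j⌋₊ + 1))))) : ℕ) : ℝ) ≤
      288 * (F.L : ℝ) ^ (3 * F.m) * R ^ 2 * β ^ 9 := by
  have hL3 : 3 ≤ F.L := three_le_of_odd F.hL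
  have hLr2 : (2 : ℝ) ≤ F.L := by exact_mod_cast (le_trans (by norm_num) hL3)
  have hLr0 : (0 : ℝ) < F.L := by linarith
  have hR0 : 0 < R := by linarith
  have hβ0 : 0 < β := by linarith
  obtain ⟨N, hN_def⟩ : ∃ N : ℕ, N = ⌊R * (F.L : ℝ) ^ j⌋₊ := ⟨_, rfl⟩
  rw [← hN_def]
  have hcardSite : (Fintype.card (Site (F.P K) 0) : ℝ) ≤ 8 * (F.L : ℝ) ^ (3 * F.m) * β ^ 6 := by
    have hc1 : Fintype.card (Site (F.P K) 0) = (2 * F.L ^ (F.m + K)) ^ 3 := by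
      rw [show Fintype.card (Site (F.P K) 0) =
          Fintype.card (Fin (F.P K).d → ZMod ((F.P K).sitesPerDir 0)) from rfl,
        Fintype.card_fun, ZMod.card, Fintype.card_fin]
      rfl
    rw [hc1]
    push_cast
    have h8 : ((2 : ℝ) * (F.L : ℝ) ^ (F.m + K)) ^ 3 = 8 * (F.L : ℝ) ^ (3 * F.m) * ((F.L : ℝ) ^ K) ^ 3 := by ring
    rw [h8]
    have hLK6 : ((F.L : ℝ) ^ K) ^ 3 ≤ β ^ 6 := by
      rw [show β ^ 6 = (β ^ 2) ^ 3 by ring]; exact pow_le_pow_left₀ (by positivity) hLKβ 3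
    exact mul_le_mul_of_nonneg_left hLK6 (by positivity)
  have e1 : ((j : ℝ) + 1) ≤ β := by
    have h2j : j + 1 ≤ 2 ^ j := Nat.lt_two_pow_self (n := j)
    calc ((j : ℝ) + 1) = ((j + 1 : ℕ) : ℝ) := by push_cast; ring
      _ ≤ ((2 ^ j : ℕ) : ℝ) := by exact_mod_cast h2j
      _ = (2 : ℝ) ^ j := by push_cast; ring
      _ ≤ (F.L : ℝ) ^ j := pow_le_pow_left₀ (by norm_num) hLr2 j
      _ ≤ β := hLjβ
  have e3 : ((N : ℝ) + 1) ≤ 2 * R * β := by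
    have hN : (N : ℝ) ≤ R * (F.L : ℝ) ^ j := by rw [hN_def]; exact Nat.floor_le (by positivity)
    have hRj : R * (F.L : ℝ) ^ j ≤ R * β := mul_le_mul_of_nonneg_left hLjβ hR0.le
    nlinarith
  have hN0 : (0 : ℝ) ≤ (N : ℝ) + 1 := by positivity
  have hNN : ((N : ℝ) + 1) * ((N : ℝ) + 1) ≤ (2 * R * β) * (2 * R * β) := mul_le_mul e3 e3 hN0 (by positivity)
  have h99 : (3 : ℝ) * (3 * (((N : ℝ) + 1) * ((N : ℝ) + 1))) ≤ 3 * (3 * ((2 * R * β) * (2 * R * β))) := by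
    linarith
  have hin : (Fintype.card (Site (F.P K) 0) : ℝ) * (3 * (3 * (((N : ℝ) + 1) * ((N : ℝ) + 1)))) ≤
      (8 * (F.L : ℝ) ^ (3 * F.m) * β ^ 6) * (3 * (3 * ((2 * R * β) * (2 * R * β)))) :=
    mul_le_mul hcardSite h99 (by positivity) (by positivity)
  push_cast
  calc ((j : ℝ) + 1) * ((Fintype.card (Site (F.P K) 0) : ℝ) * (3 * (3 * (((N : ℝ) + 1) * ((N : ℝ) + 1)))))
      ≤ β * ((8 * (F.L : ℝ) ^ (3 * F.m) * β ^ 6) * (3 * (3 * ((2 * R * β) * (2 * R * β))))) :=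
        mul_le_mul e1 hin (by positivity) hβ0.le
    _ = 288 * (F.L : ℝ) ^ (3 * F.m) * R ^ 2 * β ^ 9 := by ring

/-- **THE SHALLOW PER-PLAQUETTE TAIL** (one family `F`, one coupling `0 < γ ≤ 1`; `3j ≤ K`, depth `h = K − j ≥ 2j`).  Given the
rectangle tail of `RectangleTailL` and the deterministic domination of `ShallowRectangleDominationL` for `F` at `γ` (constants
`α, c, C, A` and `C₃, R, η₀`), a profile `(b₀, p₀)` with `α(2p₀ − 3) ≥ 2`, and the side-condition smallness
`√(L^j)·θ_{b₀}(h) ≤ 2C₃·min(η₀,1)` (`2j ≤ h`; true for `γ ≤ γ_s`, §2): the BARE event `{θ_{b₀}(h) ≤ |Ū^{j}(∂p) − 1|}` has Gibbs mass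
`≤ 288·C·L^{3m}·R^{A+2}·β_h^{3A+9}·exp(−(c·c₂)^α·p_{1,1}(g_h)²)`.  Proof: with `η = θ_{b₀}(h)/(2C₃(j+1))` the contrapositive of
the domination puts the event inside the union, over `i ≤ j`, corners `x`, directions `μ, ν` and sides `a, b ≤ R·L^j`, of the
rectangle events `{η√(L^i/L^j) ≤ |U(∂rect) − 1|}` (`≤ 288·L^{3m}R²β_h⁹` of them), each of mass
`≤ C·β_K^A(RL^j)^A·exp(−(c·c₂)^α(1+log g_h⁻¹)²)` by the rectangle tail and §3 (`β_K ≤ β_h²`, `L^j ≤ β_h`).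
[cite: Balaban1985UV3, (7) p.257] -/
theorem shallow_perPlaquette (F : T3Family) {γ α c C C₃ R η₀ b₀ p₀ : ℝ} {A : ℕ}
    (hγ : 0 < γ) (hγ1 : γ ≤ 1) (hα : 0 < α) (hc : 0 < c) (hC : 0 ≤ C) (hC₃ : 0 < C₃) (hR : 2 ≤ R)
    (hb₀ : 0 < b₀) (hαp : 2 ≤ α * (2 * p₀ - 3))
    (hRT : ∀ (K a b : ℕ) (x : Site (F.P K) 0) (μ ν : Fin (F.P K).d) (t : ℝ), μ ≠ ν → 1 ≤ a → 1 ≤ b →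
      2 * (a + b) < (F.P K).sitesPerDir 0 → 0 < t → t ≤ 1 →
      (gibbsK F T3UnitLawDensityEML.ℰp γ K).real
          {U | t ≤ GaugeGroup.dist1 (Missing.pathHol U (Missing.rectLoop x μ ν a b))} ≤
        C * (F.scheme T3UnitLawDensityEML.ℰp γ).β K ^ A * ((a : ℝ) + b) ^ A *
          Real.exp (-((c * (t ^ 2 * (F.scheme T3UnitLawDensityEML.ℰp γ).β K /
            (((a : ℝ) + b) * (1 + Real.log ((a : ℝ) + b))))) ^ α)))
    (hSD : ∀ (K j : ℕ) (q : Plaq (F.P K) j) (U : GaugeField (F.P K) 0 (Matrix.specialUnitaryGroup (Fin 2) ℂ))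
      (η : ℝ), j ≤ K → 0 < η → Real.sqrt ((F.L : ℝ) ^ j) * (j + 1) * η ≤ η₀ →
      (∀ (i a b : ℕ) (x : Site (F.P K) 0) (μ ν : Fin (F.P K).d), μ ≠ ν → i ≤ j → 1 ≤ a → 1 ≤ b →
        2 * (a + b) < (F.P K).sitesPerDir 0 → ((a : ℝ) + b) ≤ R * (F.L : ℝ) ^ i →
        GaugeGroup.dist1 (Missing.pathHol U (Missing.rectLoop x μ ν a b)) ≤
          η * Real.sqrt ((F.L : ℝ) ^ i / (F.L : ℝ) ^ j)) →
      GaugeGroup.dist1 (GaugeField.plaqHol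
        (Averaging.iter (fun i => BlockAveraging.blockAvg (P := F.P K) (j := i) T3UnitLawDensityEML.ℰp) j U) q) ≤
        C₃ * (j + 1) * η)
    (hside : ∀ j h : ℕ, 2 * j ≤ h → Real.sqrt ((F.L : ℝ) ^ j) * θBal F.L γ b₀ p₀ h ≤ 2 * C₃ * min η₀ 1)
    {K j : ℕ} (hjK : 3 * j ≤ K) (p : Plaq (F.P K) j) :
    (gibbsK F T3UnitLawDensityEML.ℰp γ K).real
        {U | θBal F.L γ b₀ p₀ (K - j) ≤ GaugeGroup.dist1 (GaugeField.plaqHol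
          (Averaging.iter (fun i => BlockAveraging.blockAvg (P := F.P K) (j := i) T3UnitLawDensityEML.ℰp) j U) p)} ≤
      (288 * C * (F.L : ℝ) ^ (3 * F.m) * R ^ (A + 2)) * ((γ * ((F.L : ℝ)⁻¹) ^ (K - j))⁻¹) ^ (3 * A + 9) *
        Real.exp (-((c * (b₀ ^ 2 / (4 * C₃ ^ 2 * R * (1 + Real.log R)))) ^ α *
          B10.pFun 1 1 (Real.sqrt (γ * ((F.L : ℝ)⁻¹) ^ (K - j))) ^ 2)) := by
  haveI := isProbabilityMeasure_gibbsK F T3UnitLawDensityEML.ℰp hγ.le K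
  have hL := F.hL
  have hL1 : 1 ≤ F.L := hL.2.le
  have hLr1 : (1 : ℝ) ≤ F.L := by exact_mod_cast hL1
  have hLr0 : (0 : ℝ) < F.L := by linarith
  have hLne : (F.L : ℝ) ≠ 0 := hLr0.ne'
  have hγne : γ ≠ 0 := hγ.ne'
  have hC₃ne : C₃ ≠ 0 := hC₃.ne'
  have hR0 : 0 < R := by linarith
  -- depth `h = K − j ≥ 2j`
  obtain ⟨h, hKjh⟩ : ∃ h, K = j + h := ⟨K - j, by omega⟩
  have hh : K - j = h := by omega
  have hjh : 2 * j ≤ h := by omega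
  have hjK' : j ≤ K := by omega
  rw [hh, pFun_one_one]
  -- the coupling at depth `h`, its logarithm, the inverse coupling
  have hℓ0 : 0 ≤ Real.log (Real.sqrt (γ * ((F.L : ℝ)⁻¹) ^ h))⁻¹ := log_inv_coupling_nonneg hL1 hγ hγ1 h
  have hjℓ : (j : ℝ) ≤ Real.log (Real.sqrt (γ * ((F.L : ℝ)⁻¹) ^ h))⁻¹ := natCast_le_log_inv hL hγ hγ1 hjh
  have hjlogℓ : (j : ℝ) * Real.log F.L ≤ Real.log (Real.sqrt (γ * ((F.L : ℝ)⁻¹) ^ h))⁻¹ :=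
    mul_log_le_log_inv hL1 hγ hγ1 hjh
  set g : ℝ := Real.sqrt (γ * ((F.L : ℝ)⁻¹) ^ h) with hg_def
  set ℓ : ℝ := Real.log g⁻¹ with hℓ_def
  set β : ℝ := (γ * ((F.L : ℝ)⁻¹) ^ h)⁻¹ with hβ_def
  have hβ1 : 1 ≤ β := one_le_beta hL1 hγ hγ1 h
  have hβ0 : 0 < β := one_pos.trans_le hβ1
  have hLjβ : (F.L : ℝ) ^ j ≤ β := by
    have := pow_le_beta_sub hL1 hγ hγ1 (K := K) (j := j) (by omega); rwa [hh] at this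
  have hLhβ : (F.L : ℝ) ^ h ≤ β := pow_le_beta hL1 hγ hγ1 h
  have hβK2 : (γ * ((F.L : ℝ)⁻¹) ^ K)⁻¹ ≤ β ^ 2 := by
    have := beta_le_beta_sq hL1 hγ hγ1 (K := K) (j := j) (by omega); rwa [hh] at this
  have hLKβ : (F.L : ℝ) ^ K ≤ β ^ 2 := by
    rw [hKjh, pow_add, sq]; exact mul_le_mul hLjβ hLhβ (by positivity) (by positivity)
  -- the threshold and `η`
  have hθ0 : 0 < θBal F.L γ b₀ p₀ h := T3MinimiserStabilityReduction.θBal_pos hL1 hγ hγ1 hb₀ p₀ h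
  set θ : ℝ := θBal F.L γ b₀ p₀ h with hθ_def
  have hθg : θ = g * (b₀ * (1 + ℓ) ^ p₀) := rfl
  have hj1 : (0 : ℝ) < (j : ℝ) + 1 := by positivity
  set η : ℝ := θ / (2 * C₃ * ((j : ℝ) + 1)) with hη_def
  have hη0 : 0 < η := by positivity
  have hC₃η : C₃ * ((j : ℝ) + 1) * η = θ / 2 := by rw [hη_def]; field_simp
  have hsqrt1 : 1 ≤ Real.sqrt ((F.L : ℝ) ^ j) := by
    rw [← Real.sqrt_one]; exact Real.sqrt_le_sqrt (one_le_pow₀ hLr1)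
  have hsθ := hside j h hjh
  have hθle : θ ≤ 2 * C₃ * min η₀ 1 := (le_mul_of_one_le_left hθ0.le hsqrt1).trans hsθ
  have hη1 : η ≤ 1 := by
    rw [hη_def, div_le_one (by positivity)]
    calc θ ≤ 2 * C₃ * min η₀ 1 := hθle
      _ ≤ 2 * C₃ * 1 := mul_le_mul_of_nonneg_left (min_le_right _ _) (by positivity)
      _ ≤ 2 * C₃ * ((j : ℝ) + 1) := mul_le_mul_of_nonneg_left (by linarith) (by positivity)
  have hsc : Real.sqrt ((F.L : ℝ) ^ j) * ((j : ℝ) + 1) * η ≤ η₀ := by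
    have heq : Real.sqrt ((F.L : ℝ) ^ j) * ((j : ℝ) + 1) * η = Real.sqrt ((F.L : ℝ) ^ j) * θ / (2 * C₃) := by
      rw [hη_def]; field_simp
    rw [heq, div_le_iff₀ (by positivity)]
    calc Real.sqrt ((F.L : ℝ) ^ j) * θ ≤ 2 * C₃ * min η₀ 1 := hsθ
      _ ≤ 2 * C₃ * η₀ := mul_le_mul_of_nonneg_left (min_le_left _ _) (by positivity)
      _ = η₀ * (2 * C₃) := by ring
  have hθη : C₃ * ((j : ℝ) + 1) * η < θ := by rw [hC₃η]; linarith
  -- the identity `η²β_K = (b₀u^{p₀})²L^j/(4C₃²(j+1)²)`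
  have hηβ : η ^ 2 * (γ * ((F.L : ℝ)⁻¹) ^ K)⁻¹ =
      (b₀ * (1 + ℓ) ^ p₀) ^ 2 * (F.L : ℝ) ^ j / (4 * C₃ ^ 2 * ((j : ℝ) + 1) ^ 2) := by
    have hg2 : g ^ 2 = γ * ((F.L : ℝ)⁻¹) ^ h := Real.sq_sqrt (by positivity)
    have hLj0 : (F.L : ℝ) ^ j ≠ 0 := pow_ne_zero j hLne
    have hLh0 : (F.L : ℝ) ^ h ≠ 0 := pow_ne_zero h hLne
    rw [hη_def, hθg, div_pow, mul_pow, hg2, hKjh, pow_add]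
    simp only [inv_pow]
    field_simp
    norm_num
  -- the uniform term and the union bound
  set cs : ℝ := (c * (b₀ ^ 2 / (4 * C₃ ^ 2 * R * (1 + Real.log R)))) ^ α with hcs_def
  have hβK0 : 0 ≤ (γ * ((F.L : ℝ)⁻¹) ^ K)⁻¹ := by positivity
  have hB0 : 0 ≤ C * ((γ * ((F.L : ℝ)⁻¹) ^ K)⁻¹) ^ A * (R * (F.L : ℝ) ^ j) ^ A * Real.exp (-(cs * (1 + ℓ) ^ 2)) := by
    positivity
  have hunion := real_bare_le_count_mul F p (gibbsK F T3UnitLawDensityEML.ℰp γ K) hR0.le hB0 hθη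
    (fun U hsm => hSD K j p U η hjK' hη0 hsc hsm)
    (fun i a b x μ ν hμν hij ha hb hab habR => rect_event_le F x μ ν (gibbsK F T3UnitLawDensityEML.ℰp γ K)
      hγ hα hc hC hC₃ hR hb₀ hαp hℓ0 hjℓ hjlogℓ hη0 hη1 hηβ
      (fun a b x μ ν t hμν ha hb hab ht0 ht1 => hRT K a b x μ ν t hμν ha hb hab ht0 ht1) hμν hij ha hb hab habR)
  -- counting and assembly
  have hcount := count_le F (K := K) (j := j) hR hβ1 hLjβ hLKβ
  have hBle : C * ((γ * ((F.L : ℝ)⁻¹) ^ K)⁻¹) ^ A * (R * (F.L : ℝ) ^ j) ^ A * Real.exp (-(cs * (1 + ℓ) ^ 2)) ≤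
      C * R ^ A * β ^ (3 * A) * Real.exp (-(cs * (1 + ℓ) ^ 2)) := by
    have ha : ((γ * ((F.L : ℝ)⁻¹) ^ K)⁻¹) ^ A ≤ (β ^ 2) ^ A := pow_le_pow_left₀ hβK0 hβK2 A
    have hb : (R * (F.L : ℝ) ^ j) ^ A ≤ (R * β) ^ A :=
      pow_le_pow_left₀ (by positivity) (mul_le_mul_of_nonneg_left hLjβ hR0.le) A
    calc C * ((γ * ((F.L : ℝ)⁻¹) ^ K)⁻¹) ^ A * (R * (F.L : ℝ) ^ j) ^ A * Real.exp (-(cs * (1 + ℓ) ^ 2))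
        ≤ C * (β ^ 2) ^ A * (R * β) ^ A * Real.exp (-(cs * (1 + ℓ) ^ 2)) :=
          mul_le_mul_of_nonneg_right (mul_le_mul (mul_le_mul_of_nonneg_left ha hC) hb (by positivity)
            (by positivity)) (Real.exp_nonneg _)
      _ = C * R ^ A * β ^ (3 * A) * Real.exp (-(cs * (1 + ℓ) ^ 2)) := by ring
  refine hunion.trans ?_
  calc _ ≤ (288 * (F.L : ℝ) ^ (3 * F.m) * R ^ 2 * β ^ 9) * (C * R ^ A * β ^ (3 * A) * Real.exp (-(cs * (1 + ℓ) ^ 2))) :=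
        mul_le_mul hcount hBle hB0 (by positivity)
    _ = (288 * C * (F.L : ℝ) ^ (3 * F.m) * R ^ (A + 2)) * β ^ (3 * A + 9) * Real.exp (-(cs * (1 + ℓ) ^ 2)) := by
        ring

end Shallow

end Summit.QuantumFields.YangMills.Theorems.RectangleDominationShallow

end
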